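import Literature.NumberTheory.Irrationality.KrattenthalerRivoal2007.WellPoisedSumAsBaileyChain
import Literature.NumberTheory.Irrationality.KrattenthalerRivoal2007.EpsilonBricks
import HarnessLib

/-!
# Proposition 6, inner part: the normalised Bailey levels at `a = 2ε−n` are products of Zudilin bricks

[KrattenthalerRivoal2007, §12, proof of Proposition 6, display (eq:briques)]: after "`S = ε·s`" (Corollaires 3–6;
tree: `wpTaylorSum_even_eq_eps_mul`, with the explicit reduced multiple sum `sPolThree`), KR "arrange the terms
containing `ε` in the summand of `s_{A,B,r}(n)` in terms of bricks": every level `i_k` of the multiple sum, suitably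
normalised, is an integer times a product of elementary bricks `R(α,β;±ε+K)`, `R(α,β;±ε)·(±ε)`, `R(i,0;1+2ε)`
(Lemme 9) — so that, by Leibniz, `d_n^{ℓ}(1/ℓ!)∂^{ℓ}(level)|_{ε=0} ∈ ℤ`.

This file does this for the INNER levels of the tree's normal form (the factor
`(1+2ε)_k k! · tailProd a T k (n−k) · reducedMultiSum a T k` of `sPolThree`, `T = corThreeTail ε n M B' r`,
`a = 2ε−n`, `x = ε−n`, `y = rn+ε+1`), grouping — as KR do, `(b_{j+1})_{i_j}/(1+a−b_j)_{i_j}` — the numerator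
parameters of each pair with the denominator parameters of the pair below it at the same index:
* the level functions `lvlOne` (`(1+2ε,1)` above `(x,x)`: `R(k,0;1+2ε)·(R(0,k+1;ε)ε)²`), `lvlXX` (`(x,x)` above `(x,x)`:
  `(C(n,k) R(0,k+1;ε)ε R(0,n−k+1;−ε)(−ε))²`), `lvlXY` (`(x,x)` above `(x,y)`), `lvlYY` (`(x,y)` above `(x,y)`:
  `∏_q R(n,0;nq−k+…−ε) ∏_q R(n,0;nq+k+ε+1)`-type), each `IsDInt (d_n)` at `0` (`EpsilonBricks.lean`);
* the recursively defined normalised inner sums `innerYY`, `innerX`, `innerXX`, `inner` and **`inner_isDInt`**;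
* the raw inner sums `rawYY`, `rawX`, `rawXX`, `rawInner` (= `(1+2ε)_k k!·tailProd·reducedMultiSum` of `sPolThree`)
  with their Bailey recursions, the four level identities, and the **dictionary** `rawInner_dictionary`:
  `E(ε) · rawInner = D(ε) · inner` with explicit products `E`, `D` of `n!`, `(1∓ε)_n`, `(1∓ε)_{rn}`.
* the multinomial refinement `innerFlat` (integer weights `wXX = C(n+k−i,k−i)`, `wXY = ±C(rn,k−i)`):
  **`inner_eq_flat`** (`inner(k) = k!·innerFlat(k)`) and **`innerFlat_isDInt`** — the top level consumes this `k!`.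
The TOP level (indices `k`, `u` of `sPolThree`, with the special bricks `R₁`, `R₂` of Lemme 10) is not treated here.

## References
* [KrattenthalerRivoal2007] C. Krattenthaler, T. Rivoal, Mem. AMS 186 (2007), §12 proof of Prop. 6, (eq:briques)
  (arXiv:math/0311114 p. 29); §11 Lemmes 9–10.
-/

open Finset Filter
open scoped Nat
open Literature.NumberTheory.Transcendental
open Literature.Combinatorics.Enumerative.BaileyChain
open Literature.Combinatorics.Enumerative (balFourFThree)

namespace Literature.NumberTheory.Irrationality.KrattenthalerRivoal2007

/-! ### Rising factorials (private shorthand) -/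

/-- `(z)_m` (private shorthand). [folklore] -/
private def pw (z : ℚ) (m : ℕ) : ℚ := ∏ i ∈ range m, (z + i)

/-- Unfolding. [folklore] -/
private theorem pw_def (z : ℚ) (m : ℕ) : pw z m = ∏ i ∈ range m, (z + i) := rfl

/-- `(z)_{m₁+m₂} = (z)_{m₁}(z+m₁)_{m₂}`. [folklore] -/
private theorem pw_add (z : ℚ) (m₁ m₂ : ℕ) : pw z (m₁ + m₂) = pw z m₁ * pw (z + m₁) m₂ := by
  simp only [pw, prod_range_add]
  congr 1
  refine prod_congr rfl fun i _ => ?_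
  push_cast
  ring

/-- Congruence. [folklore] -/
private theorem pw_congr {z z' : ℚ} (h : z = z') (m : ℕ) : pw z m = pw z' m := by rw [h]

/-- `(z)_{m+1} = (z)_m (z+m)`. [folklore] -/
private theorem pw_succ (z : ℚ) (m : ℕ) : pw z (m + 1) = pw z m * (z + m) := by
  simp [pw, prod_range_succ]

/-- `(z)_{m+1} = z (z+1)_m`. [folklore] -/
private theorem pw_succ_left (z : ℚ) (m : ℕ) : pw z (m + 1) = z * pw (z + 1) m := by
  induction m with
  | zero => simp [pw]
  | succ m ih =>
    rw [pw_succ, ih, pw_succ]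
    push_cast
    ring

/-- Reflection `(−z)_m = (−1)^m (z−m+1)_m`. [folklore] -/
private theorem pw_neg_rev (z : ℚ) (m : ℕ) : pw (-z) m = (-1) ^ m * pw (z - m + 1) m := by
  induction m with
  | zero => simp [pw]
  | succ m ih =>
    rw [pw_succ, ih, pw_succ_left,
      pw_congr (show z - ((m + 1 : ℕ) : ℚ) + 1 + 1 = z - (m : ℕ) + 1 by push_cast; ring) m]
    push_cast
    ring

/-- Blocks: `(z)_{rn} = ∏_{q<r} (z+qn)_n`. [folklore] -/
private theorem pw_mul_blocks (z : ℚ) (r n : ℕ) : pw z (r * n) = ∏ q ∈ range r, pw (z + q * n) n := by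
  induction r with
  | zero => simp [pw]
  | succ r ih =>
    rw [Nat.succ_mul, pw_add, ih, prod_range_succ]
    congr 1
    exact pw_congr (by push_cast; ring) n

variable (n r : ℕ)

/-! ### The bricks in `ε`-form -/

/-- `R(0,i+1;ε)·ε = i!/(1+ε)_i`. [cite: KrattenthalerRivoal2007, §11 Lemme 9; §12 (eq:briques)] -/
def rbPlus (i : ℕ) (ε : ℚ) : ℚ := (i ! : ℚ) / ∏ l ∈ range i, (1 + ε + l)

/-- `R(0,i+1;−ε)·(−ε) = i!/(1−ε)_i`. [cite: KrattenthalerRivoal2007, §11 Lemme 9; §12 (eq:briques)] -/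
def rbMinus (i : ℕ) (ε : ℚ) : ℚ := (i ! : ℚ) / ∏ l ∈ range i, (1 - ε + l)

/-- `∏_{q<r} R(n,0; K+qn−ε) = (K−ε)_{rn}/n!^r` (blocks of length `n`, so that `d_n` suffices).
[cite: KrattenthalerRivoal2007, §12 (eq:briques) (the products ∏_q R(n,0;nq−i−ε+1))] -/
def pbBlockMinus (K : ℕ) (ε : ℚ) : ℚ := ∏ q ∈ range r, polyBrick ((K + q * n : ℕ) : ℤ) n (-ε)

/-- `∏_{q<r} R(n,0; K+qn+ε) = (K+ε)_{rn}/n!^r`. [cite: KrattenthalerRivoal2007, §12 (eq:briques) (∏_q R(n,0;nq+i+ε+1))] -/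
def pbBlockPlus (K : ℕ) (ε : ℚ) : ℚ := ∏ q ∈ range r, polyBrick ((K + q * n : ℕ) : ℤ) n ε

variable {n r}

/-- `rbPlus` is `IsDInt (d_n)` at `0` for `i ≤ n`. [cite: KrattenthalerRivoal2007, §11 Lemme 9] -/
theorem rbPlus_isDInt {i : ℕ} (hi : i ≤ n) (N : ℕ) : IsDInt (Nat.lcmUpto n) N (rbPlus i) 0 := by
  refine (recipBrick_eps_isDInt hi N).congr (Eventually.of_forall fun ε => ?_)
  show (i ! : ℚ) / ∏ l ∈ range i, (ε + 1 + l) = (i ! : ℚ) / ∏ l ∈ range i, (1 + ε + l)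
  congr 1
  exact prod_congr rfl fun l _ => by ring

/-- `rbMinus` is `IsDInt (d_n)` at `0` for `i ≤ n`. [cite: KrattenthalerRivoal2007, §11 Lemme 9] -/
theorem rbMinus_isDInt {i : ℕ} (hi : i ≤ n) (N : ℕ) : IsDInt (Nat.lcmUpto n) N (rbMinus i) 0 :=
  (recipBrick_neg_eps_isDInt hi N).congr (Eventually.of_forall fun _ => rfl)

/-- `pbBlockMinus` is `IsDInt (d_n)` at `0`. [cite: KrattenthalerRivoal2007, §11 Lemme 9] -/
theorem pbBlockMinus_isDInt (K N : ℕ) : IsDInt (Nat.lcmUpto n) N (pbBlockMinus n r K) 0 :=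
  IsDInt.prod (F := fun q ε => polyBrick ((K + q * n : ℕ) : ℤ) n (-ε)) _ fun _ _ =>
    polyBrick_neg_eps_isDInt _ le_rfl N

/-- `pbBlockPlus` is `IsDInt (d_n)` at `0`. [cite: KrattenthalerRivoal2007, §11 Lemme 9] -/
theorem pbBlockPlus_isDInt (K N : ℕ) : IsDInt (Nat.lcmUpto n) N (pbBlockPlus n r K) 0 :=
  IsDInt.prod (F := fun q ε => polyBrick ((K + q * n : ℕ) : ℤ) n ε) _ fun _ _ =>
    polyBrick_eps_isDInt _ le_rfl N

/-! ### The normalised levels -/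

/-- Level `(1+2ε, 1)` above `(x,x)`: `R(k,0;1+2ε) · (R(0,k+1;ε)ε)² = (1+2ε)_k/k! · (k!/(1+ε)_k)²`.
[cite: KrattenthalerRivoal2007, §12 (eq:briques) (the factors R(i,0;1+2ε) R(0,i+1;ε)ε R(0,i+1;ε)ε)] -/
def lvlOne (k : ℕ) (ε : ℚ) : ℚ := polyBrick 1 k (2 * ε) * rbPlus k ε ^ 2

/-- Level `(x,x)` above `(x,x)`: `(C(n,k) R(0,k+1;ε)ε R(0,n−k+1;−ε)(−ε))² = (n!/((1+ε)_k(1−ε)_{n−k}))²`.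
[cite: KrattenthalerRivoal2007, §12 (eq:briques) (the factors binom(n,i_k) R(0,i_k+1;ε)ε R(0,n−i_k+1;−ε)(−ε), squared)] -/
def lvlXX (n k : ℕ) (ε : ℚ) : ℚ := ((n.choose k : ℚ) * rbPlus k ε * rbMinus (n - k) ε) ^ 2

/-- Level `(x,x)` above `(x,y)`: `(−1)^{n−k} C(n,k) R(0,k+1;ε)ε R(0,n−k+1;−ε)(−ε) · ∏_q R(n,0;nq+n−k+1−ε)`.
[cite: KrattenthalerRivoal2007, §12 (eq:briques) (level i_{B−1})] -/
def lvlXY (n r k : ℕ) (ε : ℚ) : ℚ :=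
  (-1) ^ (n - k) * ((n.choose k : ℚ) * rbPlus k ε * rbMinus (n - k) ε) * pbBlockMinus n r (n - k + 1) ε

/-- Level `(x,y)` above `(x,y)`: `(−1)^n ∏_q R(n,0;nq+n−k+1−ε) ∏_q R(n,0;nq+k+1+ε)`.
[cite: KrattenthalerRivoal2007, §12 (eq:briques) (levels k ≤ B−2)] -/
def lvlYY (n r k : ℕ) (ε : ℚ) : ℚ := (-1) ^ n * pbBlockMinus n r (n - k + 1) ε * pbBlockPlus n r (k + 1) ε

/-- `lvlOne` is `IsDInt (d_n)` at `0` (`k ≤ n`). [cite: KrattenthalerRivoal2007, §12 proof of Prop. 6 (Lemme 9 per brick)] -/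
theorem lvlOne_isDInt {k : ℕ} (hk : k ≤ n) (N : ℕ) : IsDInt (Nat.lcmUpto n) N (lvlOne k) 0 :=
  (polyBrick_two_eps_isDInt 1 hk N).mul ((rbPlus_isDInt hk N).pow 2)

/-- `lvlXX` is `IsDInt (d_n)` at `0` (`k ≤ n`). [cite: KrattenthalerRivoal2007, §12 proof of Prop. 6] -/
theorem lvlXX_isDInt {k : ℕ} (hk : k ≤ n) (N : ℕ) : IsDInt (Nat.lcmUpto n) N (lvlXX n k) 0 :=
  ((((IsDInt.const _ N (n.choose k : ℤ) 0).congr (Eventually.of_forall fun _ => by push_cast; rfl)).mul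
    (rbPlus_isDInt hk N)).mul (rbMinus_isDInt (Nat.sub_le n k) N)).pow 2

/-- `lvlXY` is `IsDInt (d_n)` at `0` (`k ≤ n`). [cite: KrattenthalerRivoal2007, §12 proof of Prop. 6] -/
theorem lvlXY_isDInt {k : ℕ} (hk : k ≤ n) (N : ℕ) : IsDInt (Nat.lcmUpto n) N (lvlXY n r k) 0 := by
  have h := ((((IsDInt.const _ N (n.choose k : ℤ) 0).congr (Eventually.of_forall fun _ => by push_cast; rfl)).mul
    (rbPlus_isDInt hk N)).mul (rbMinus_isDInt (Nat.sub_le n k) N)).mul (pbBlockMinus_isDInt (r := r) (n - k + 1) N)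
  refine (h.int_mul ((-1) ^ (n - k))).congr (Eventually.of_forall fun ε => ?_)
  unfold lvlXY
  push_cast
  ring

/-- `lvlYY` is `IsDInt (d_n)` at `0`. [cite: KrattenthalerRivoal2007, §12 proof of Prop. 6] -/
theorem lvlYY_isDInt (k N : ℕ) : IsDInt (Nat.lcmUpto n) N (lvlYY n r k) 0 := by
  have h := (pbBlockMinus_isDInt (n := n) (r := r) (n - k + 1) N).mul (pbBlockPlus_isDInt (n := n) (r := r) (k + 1) N)
  refine (h.int_mul ((-1) ^ n)).congr (Eventually.of_forall fun ε => ?_)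
  unfold lvlYY
  push_cast
  ring

/-! ### The normalised inner sums (recursion along the chain, innermost `(x,y)` levels first) -/

/-- The gap factor `(1+a−b−c)_{k−i}`: `(n+1)_{k−i}` between two `x`'s, `(−rn)_{k−i}` between `x` and `y` — integers.
[cite: KrattenthalerRivoal2007, §12 (eq:briques) (R(i_k−i_{k−1},0;n+1), binom(rn, i_k−i_{k−1}))] -/
def gapXX (n k i : ℕ) : ℚ := ∏ j ∈ range (k - i), ((n : ℚ) + 1 + j)

/-- See `gapXX`. [cite: KrattenthalerRivoal2007, §12 (eq:briques)] -/
def gapXY (n r k i : ℕ) : ℚ := ∏ j ∈ range (k - i), (-((r * n : ℕ) : ℚ) + j)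

/-- Normalised chain of `b` pairs `(x,y)` below a pair `(x,y)`. [cite: KrattenthalerRivoal2007, §12 (eq:briques)] -/
def innerYY (n r : ℕ) : ℕ → ℕ → ℚ → ℚ
  | 0, k, _ => if k = 0 then 1 else 0
  | b + 1, k, ε => lvlYY n r k ε * ∑ i ∈ range (k + 1), (k.choose i : ℚ) * gapXY n r k i * innerYY n r b i ε

/-- Normalised chain of `B'` pairs `(x,y)` below a pair `(x,x)`. [cite: KrattenthalerRivoal2007, §12 (eq:briques)] -/
def innerX (n r : ℕ) : ℕ → ℕ → ℚ → ℚ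
  | 0, k, _ => if k = 0 then 1 else 0
  | b + 1, k, ε => lvlXY n r k ε * ∑ i ∈ range (k + 1), (k.choose i : ℚ) * gapXY n r k i * innerYY n r b i ε

/-- Normalised chain of `m'` pairs `(x,x)` followed by `B'` pairs `(x,y)`, below a pair `(x,x)`.
[cite: KrattenthalerRivoal2007, §12 (eq:briques)] -/
def innerXX (n r B' : ℕ) : ℕ → ℕ → ℚ → ℚ
  | 0, k, ε => innerX n r B' k ε
  | m' + 1, k, ε => lvlXX n k ε * ∑ i ∈ range (k + 1), (k.choose i : ℚ) * gapXX n k i * innerXX n r B' m' i ε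

/-- The whole normalised inner chain below the pair `(1+2ε, 1)`: `M+1` pairs `(x,x)`, then `B'` pairs `(x,y)`
(= the tail `corThreeTail ε n M B' r`). [cite: KrattenthalerRivoal2007, §12 (eq:briques)] -/
def inner (n r M B' k : ℕ) (ε : ℚ) : ℚ :=
  lvlOne k ε * ∑ i ∈ range (k + 1), (k.choose i : ℚ) * gapXX n k i * innerXX n r B' M i ε

/-- An `ε`-free rational that is an integer is `IsDInt`. [folklore] -/
private theorem isDInt_natCast_fun (d N : ℕ) (c : ℚ) (hc : ∃ z : ℤ, c = z) : IsDInt d N (fun _ : ℚ => c) 0 := by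
  obtain ⟨z, rfl⟩ := hc
  exact IsDInt.const d N z 0

/-- The gap factors are integers. [folklore] -/
private theorem gapXX_isDInt (d N n k i : ℕ) : IsDInt d N (fun _ : ℚ => gapXX n k i) 0 :=
  isDInt_natCast_fun d N _ ⟨∏ j ∈ range (k - i), ((n : ℤ) + 1 + j), by unfold gapXX; push_cast; rfl⟩

/-- The gap factors are integers. [folklore] -/
private theorem gapXY_isDInt (d N n r k i : ℕ) : IsDInt d N (fun _ : ℚ => gapXY n r k i) 0 :=
  isDInt_natCast_fun d N _ ⟨∏ j ∈ range (k - i), (-((r * n : ℕ) : ℤ) + j), by unfold gapXY; push_cast; rfl⟩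

/-- The unit `[k = 0]` is `IsDInt`. [folklore] -/
private theorem isDInt_ite (d N k : ℕ) : IsDInt d N (fun _ : ℚ => if k = 0 then (1 : ℚ) else 0) 0 := by
  split_ifs
  · exact IsDInt.one d N 0
  · exact (IsDInt.const d N 0 0).congr (Eventually.of_forall fun _ => by simp)

/-- `innerYY` is `IsDInt (d_n)` at `0` for `k ≤ n`. [cite: KrattenthalerRivoal2007, §12 proof of Prop. 6] -/
theorem innerYY_isDInt (N : ℕ) : ∀ b k, k ≤ n → IsDInt (Nat.lcmUpto n) N (innerYY n r b k) 0 := by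
  intro b
  induction b with
  | zero => intro k _; exact isDInt_ite _ N k
  | succ b ih =>
    intro k hk
    have hs := IsDInt.sum (range (k + 1)) (F := fun i ε => (k.choose i : ℚ) * gapXY n r k i * innerYY n r b i ε)
      (d := Nat.lcmUpto n) (N := N) (x := 0) fun i hi => by
        have hik : i ≤ k := Nat.lt_succ_iff.mp (mem_range.mp hi)
        exact ((isDInt_natCast_fun _ N _ ⟨k.choose i, by push_cast; rfl⟩).mul (gapXY_isDInt _ N n r k i)).mul
          (ih i (hik.trans hk))
    exact ((lvlYY_isDInt (n := n) (r := r) k N).mul hs).congr (Eventually.of_forall fun ε => by simp [innerYY])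

/-- `innerX` is `IsDInt (d_n)` at `0` for `k ≤ n`. [cite: KrattenthalerRivoal2007, §12 proof of Prop. 6] -/
theorem innerX_isDInt (N B' k : ℕ) (hk : k ≤ n) : IsDInt (Nat.lcmUpto n) N (innerX n r B' k) 0 := by
  cases B' with
  | zero => exact isDInt_ite _ N k
  | succ b =>
    have hs := IsDInt.sum (range (k + 1)) (F := fun i ε => (k.choose i : ℚ) * gapXY n r k i * innerYY n r b i ε)
      (d := Nat.lcmUpto n) (N := N) (x := 0) fun i hi => by
        have hik : i ≤ k := Nat.lt_succ_iff.mp (mem_range.mp hi)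
        exact ((isDInt_natCast_fun _ N _ ⟨k.choose i, by push_cast; rfl⟩).mul (gapXY_isDInt _ N n r k i)).mul
          (innerYY_isDInt N b i (hik.trans hk))
    exact ((lvlXY_isDInt (r := r) hk N).mul hs).congr (Eventually.of_forall fun ε => by simp [innerX])

/-- `innerXX` is `IsDInt (d_n)` at `0` for `k ≤ n`. [cite: KrattenthalerRivoal2007, §12 proof of Prop. 6] -/
theorem innerXX_isDInt (N B' : ℕ) : ∀ m' k, k ≤ n → IsDInt (Nat.lcmUpto n) N (innerXX n r B' m' k) 0 := by
  intro m'
  induction m' with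
  | zero => intro k hk; exact (innerX_isDInt (r := r) N B' k hk).congr (Eventually.of_forall fun ε => by simp [innerXX])
  | succ m' ih =>
    intro k hk
    have hs := IsDInt.sum (range (k + 1)) (F := fun i ε => (k.choose i : ℚ) * gapXX n k i * innerXX n r B' m' i ε)
      (d := Nat.lcmUpto n) (N := N) (x := 0) fun i hi => by
        have hik : i ≤ k := Nat.lt_succ_iff.mp (mem_range.mp hi)
        exact ((isDInt_natCast_fun _ N _ ⟨k.choose i, by push_cast; rfl⟩).mul (gapXX_isDInt _ N n k i)).mul
          (ih i (hik.trans hk))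
    exact ((lvlXX_isDInt hk N).mul hs).congr (Eventually.of_forall fun ε => by simp [innerXX])

/-- **The normalised inner chain is `d_n`-integral to all orders**: for `k ≤ n` and every `N`,
`d_n^j · (1/j!) ∂^j/∂ε^j inner(k)(ε)|_{ε=0} ∈ ℤ` (`j ≤ N`) — Leibniz over the levels, each level a product of bricks
(KR: "la quantité `d_n^{ℓ_k}(1/ℓ_k!)∂^{ℓ_k} t_k|_{ε=0}` est un nombre entier pour tout `k`").
[cite: KrattenthalerRivoal2007, §12 proof of Proposition 6, (eq:briques)–(eq:6)] -/
theorem inner_isDInt (N M B' k : ℕ) (hk : k ≤ n) : IsDInt (Nat.lcmUpto n) N (inner n r M B' k) 0 := by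
  have hs := IsDInt.sum (range (k + 1)) (F := fun i ε => (k.choose i : ℚ) * gapXX n k i * innerXX n r B' M i ε)
    (d := Nat.lcmUpto n) (N := N) (x := 0) fun i hi => by
      have hik : i ≤ k := Nat.lt_succ_iff.mp (mem_range.mp hi)
      exact ((isDInt_natCast_fun _ N _ ⟨k.choose i, by push_cast; rfl⟩).mul (gapXX_isDInt _ N n k i)).mul
        (innerXX_isDInt N B' M i (hik.trans hk))
  exact ((lvlOne_isDInt hk N).mul hs).congr (Eventually.of_forall fun ε => by simp [inner])

/-! ### The raw inner sums and their Bailey recursions -/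

/-- Running product of a cons (local unfolding). [folklore] -/
private theorem tailProd_cons' (A b c : ℚ) (L : List (ℚ × ℚ)) (k : ℚ) (m : ℕ) :
    tailProd A ((b, c) :: L) k m =
      (∏ i ∈ range m, (1 + A - b + k + (i : ℚ))) * (∏ i ∈ range m, (1 + A - c + k + (i : ℚ))) * tailProd A L k m := by
  simp only [tailProd, List.map_cons, List.prod_cons]

/-- Running product of the empty list. [folklore] -/
private theorem tailProd_nil' (A : ℚ) (k : ℚ) (m : ℕ) : tailProd A [] k m = 1 := by simp [tailProd]

/-- Gluing of running products: `tailProd L k (n−k) · tailProd L i (k−i) = tailProd L i (n−i)` (`i ≤ k ≤ n`). [folklore] -/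
private theorem tailProd_glue' (A : ℚ) (L : List (ℚ × ℚ)) {i k n : ℕ} (hik : i ≤ k) (hkn : k ≤ n) :
    tailProd A L (k : ℚ) (n - k) * tailProd A L (i : ℚ) (k - i) = tailProd A L (i : ℚ) (n - i) := by
  induction L with
  | nil => simp [tailProd]
  | cons bc L ih =>
    obtain ⟨b, c⟩ := bc
    rw [tailProd_cons', tailProd_cons', tailProd_cons', ← ih, ← pw_def, ← pw_def, ← pw_def, ← pw_def, ← pw_def, ← pw_def,
      show n - i = (k - i) + (n - k) by omega, pw_add, pw_add,
      pw_congr (show 1 + A - b + (i : ℚ) + ((k - i : ℕ) : ℚ) = 1 + A - b + (k : ℚ) by rw [Nat.cast_sub hik]; ring) (n - k),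
      pw_congr (show 1 + A - c + (i : ℚ) + ((k - i : ℕ) : ℚ) = 1 + A - c + (k : ℚ) by rw [Nat.cast_sub hik]; ring) (n - k)]
    ring

/-- Raw chain of `b` pairs `(x,y)` below `(x,y)` (head of the outer pair included):
`(x)_k (y)_k · tailProd a ((x,y)^b) k (n−k) · reducedMultiSum a ((x,y)^b) k`.
[cite: KrattenthalerRivoal2007, §12 (eq:briques)] -/
def rawYY (n r b k : ℕ) (ε : ℚ) : ℚ :=
  (∏ j ∈ range k, (ε - n + j)) * (∏ j ∈ range k, (((r * n : ℕ) : ℚ) + ε + 1 + j)) *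
    tailProd (2 * ε - n) (List.replicate b (ε - n, ((r * n : ℕ) : ℚ) + ε + 1)) k (n - k) *
    reducedMultiSum (2 * ε - n) (List.replicate b (ε - n, ((r * n : ℕ) : ℚ) + ε + 1)) k

/-- Raw chain of `B'` pairs `(x,y)` below `(x,x)`. [cite: KrattenthalerRivoal2007, §12 (eq:briques)] -/
def rawX (n r B' k : ℕ) (ε : ℚ) : ℚ :=
  (∏ j ∈ range k, (ε - n + j)) ^ 2 *
    tailProd (2 * ε - n) (List.replicate B' (ε - n, ((r * n : ℕ) : ℚ) + ε + 1)) k (n - k) *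
    reducedMultiSum (2 * ε - n) (List.replicate B' (ε - n, ((r * n : ℕ) : ℚ) + ε + 1)) k

/-- Raw chain of `m'` pairs `(x,x)` and `B'` pairs `(x,y)` below `(x,x)`. [cite: KrattenthalerRivoal2007, §12 (eq:briques)] -/
def rawXX (n r B' m' k : ℕ) (ε : ℚ) : ℚ :=
  (∏ j ∈ range k, (ε - n + j)) ^ 2 *
    tailProd (2 * ε - n) (List.replicate m' (ε - n, ε - n) ++ List.replicate B' (ε - n, ((r * n : ℕ) : ℚ) + ε + 1))
      k (n - k) *
    reducedMultiSum (2 * ε - n)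
      (List.replicate m' (ε - n, ε - n) ++ List.replicate B' (ε - n, ((r * n : ℕ) : ℚ) + ε + 1)) k

/-- The raw inner factor of `sPolThree`: `(1+2ε)_k k! · tailProd a T k (n−k) · reducedMultiSum a T k`,
`T = corThreeTail ε n M B' r`. [cite: KrattenthalerRivoal2007, §12 (eq:briques)] -/
def rawInner (n r M B' k : ℕ) (ε : ℚ) : ℚ :=
  (∏ j ∈ range k, (1 + 2 * ε + j)) * (∏ j ∈ range k, ((1 : ℚ) + j)) *
    tailProd (2 * ε - n) (corThreeTail ε n M B' r) k (n - k) * reducedMultiSum (2 * ε - n) (corThreeTail ε n M B' r) k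

/-- The raw level brackets (numerators of the outer pair at `k`, denominators of this pair from `k` on).
[cite: KrattenthalerRivoal2007, §12 (eq:briques)] -/
def brYY (n r k : ℕ) (ε : ℚ) : ℚ :=
  (∏ j ∈ range k, (ε - n + j)) * (∏ j ∈ range k, (((r * n : ℕ) : ℚ) + ε + 1 + j)) *
    (∏ i ∈ range (n - k), (1 + (2 * ε - n) - (ε - n) + k + (i : ℚ))) *
    ∏ i ∈ range (n - k), (1 + (2 * ε - n) - (((r * n : ℕ) : ℚ) + ε + 1) + k + (i : ℚ))

/-- See `brYY`. [cite: KrattenthalerRivoal2007, §12 (eq:briques)] -/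
def brXY (n r k : ℕ) (ε : ℚ) : ℚ :=
  (∏ j ∈ range k, (ε - n + j)) ^ 2 *
    (∏ i ∈ range (n - k), (1 + (2 * ε - n) - (ε - n) + k + (i : ℚ))) *
    ∏ i ∈ range (n - k), (1 + (2 * ε - n) - (((r * n : ℕ) : ℚ) + ε + 1) + k + (i : ℚ))

/-- See `brYY`. [cite: KrattenthalerRivoal2007, §12 (eq:briques)] -/
def brXX (n k : ℕ) (ε : ℚ) : ℚ :=
  (∏ j ∈ range k, (ε - n + j)) ^ 2 * (∏ i ∈ range (n - k), (1 + (2 * ε - n) - (ε - n) + k + (i : ℚ))) ^ 2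

/-- See `brYY`. [cite: KrattenthalerRivoal2007, §12 (eq:briques)] -/
def brOne (n k : ℕ) (ε : ℚ) : ℚ :=
  (∏ j ∈ range k, (1 + 2 * ε + j)) * (∏ j ∈ range k, ((1 : ℚ) + j)) *
    (∏ i ∈ range (n - k), (1 + (2 * ε - n) - (ε - n) + k + (i : ℚ))) ^ 2

/-- `rawYY 0 k = [k = 0]`. [cite: KrattenthalerRivoal2007, §12 (eq:briques)] -/
theorem rawYY_zero (n r k : ℕ) (ε : ℚ) : rawYY n r 0 k ε = if k = 0 then 1 else 0 := by
  unfold rawYY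
  rw [List.replicate_zero, tailProd_nil', reducedMultiSum_nil]
  split_ifs with h
  · subst h; simp
  · simp

/-- Bailey recursion of `rawYY`. [cite: KrattenthalerRivoal2007, §12 (eq:briques)] -/
theorem rawYY_succ (n r b k : ℕ) (hk : k ≤ n) (ε : ℚ) :
    rawYY n r (b + 1) k ε = brYY n r k ε * ∑ i ∈ range (k + 1), (k.choose i : ℚ) * gapXY n r k i * rawYY n r b i ε := by
  unfold rawYY brYY gapXY
  rw [List.replicate_succ, reducedMultiSum_cons, tailProd_cons']
  simp only [mul_sum]
  refine sum_congr rfl fun i hi => ?_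
  have hik : i ≤ k := Nat.lt_succ_iff.mp (mem_range.mp hi)
  rw [← tailProd_glue' (2 * ε - n) _ hik hk]
  have e : (1 : ℚ) + (2 * ε - n) - (ε - n) - (((r * n : ℕ) : ℚ) + ε + 1) = -((r * n : ℕ) : ℚ) := by ring
  rw [e]
  ring

/-- `rawX 0 k = [k = 0]`. [cite: KrattenthalerRivoal2007, §12 (eq:briques)] -/
theorem rawX_zero (n r k : ℕ) (ε : ℚ) : rawX n r 0 k ε = if k = 0 then 1 else 0 := by
  unfold rawX
  rw [List.replicate_zero, tailProd_nil', reducedMultiSum_nil]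
  split_ifs with h
  · subst h; simp
  · simp

/-- Bailey recursion of `rawX`. [cite: KrattenthalerRivoal2007, §12 (eq:briques)] -/
theorem rawX_succ (n r b k : ℕ) (hk : k ≤ n) (ε : ℚ) :
    rawX n r (b + 1) k ε = brXY n r k ε * ∑ i ∈ range (k + 1), (k.choose i : ℚ) * gapXY n r k i * rawYY n r b i ε := by
  unfold rawX rawYY brXY gapXY
  rw [List.replicate_succ, reducedMultiSum_cons, tailProd_cons']
  simp only [mul_sum]
  refine sum_congr rfl fun i hi => ?_
  have hik : i ≤ k := Nat.lt_succ_iff.mp (mem_range.mp hi)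
  rw [← tailProd_glue' (2 * ε - n) _ hik hk]
  have e : (1 : ℚ) + (2 * ε - n) - (ε - n) - (((r * n : ℕ) : ℚ) + ε + 1) = -((r * n : ℕ) : ℚ) := by ring
  rw [e]
  ring

/-- `rawXX` at `m' = 0` is `rawX`. [cite: KrattenthalerRivoal2007, §12 (eq:briques)] -/
theorem rawXX_zero (n r B' k : ℕ) (ε : ℚ) : rawXX n r B' 0 k ε = rawX n r B' k ε := by
  unfold rawXX rawX
  rw [List.replicate_zero, List.nil_append]

/-- Bailey recursion of `rawXX`. [cite: KrattenthalerRivoal2007, §12 (eq:briques)] -/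
theorem rawXX_succ (n r B' m' k : ℕ) (hk : k ≤ n) (ε : ℚ) :
    rawXX n r B' (m' + 1) k ε =
      brXX n k ε * ∑ i ∈ range (k + 1), (k.choose i : ℚ) * gapXX n k i * rawXX n r B' m' i ε := by
  unfold rawXX brXX gapXX
  rw [List.replicate_succ, List.cons_append, reducedMultiSum_cons, tailProd_cons']
  simp only [mul_sum]
  refine sum_congr rfl fun i hi => ?_
  have hik : i ≤ k := Nat.lt_succ_iff.mp (mem_range.mp hi)
  rw [← tailProd_glue' (2 * ε - n) _ hik hk]
  have e : (1 : ℚ) + (2 * ε - n) - (ε - n) - (ε - n) = (n : ℚ) + 1 := by ring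
  rw [e]
  ring

/-- Bailey recursion of `rawInner` (first level: the pair `(x,x)` below `(1+2ε,1)`).
[cite: KrattenthalerRivoal2007, §12 (eq:briques)] -/
theorem rawInner_eq (n r M B' k : ℕ) (hk : k ≤ n) (ε : ℚ) :
    rawInner n r M B' k ε =
      brOne n k ε * ∑ i ∈ range (k + 1), (k.choose i : ℚ) * gapXX n k i * rawXX n r B' M i ε := by
  unfold rawInner rawXX brOne gapXX corThreeTail
  rw [List.replicate_succ, List.cons_append, reducedMultiSum_cons, tailProd_cons']
  simp only [mul_sum]
  refine sum_congr rfl fun i hi => ?_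
  have hik : i ≤ k := Nat.lt_succ_iff.mp (mem_range.mp hi)
  rw [← tailProd_glue' (2 * ε - n) _ hik hk]
  have e : (1 : ℚ) + (2 * ε - n) - (ε - n) - (ε - n) = (n : ℚ) + 1 := by ring
  rw [e]
  ring

/-! ### The level identities (raw bracket × normaliser = brick form) -/

/-- `(ε−n)_k (1−ε)_{n−k} = (−1)^k (1−ε)_n`. [folklore] -/
private theorem core_m {n k : ℕ} (hk : k ≤ n) (ε : ℚ) :
    (∏ j ∈ range k, (ε - n + j)) * (∏ l ∈ range (n - k), (1 - ε + (l : ℚ))) = (-1) ^ k * ∏ l ∈ range n, (1 - ε + (l : ℚ)) := by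
  rw [← pw_def, ← pw_def, ← pw_def, pw_congr (show ε - (n : ℚ) = -((n : ℚ) - ε) by ring) k, pw_neg_rev]
  have h : pw (1 - ε) n = pw (1 - ε) (n - k) * pw (1 - ε + ((n - k : ℕ) : ℚ)) k := by
    rw [← pw_add, Nat.sub_add_cancel hk]
  rw [h, pw_congr (show (n : ℚ) - ε - (k : ℕ) + 1 = 1 - ε + ((n - k : ℕ) : ℚ) by rw [Nat.cast_sub hk]; ring) k]
  ring

/-- `(1+ε+k)_{n−k} (1+ε)_k = (1+ε)_n`. [folklore] -/
private theorem core_p {n k : ℕ} (hk : k ≤ n) (ε : ℚ) :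
    (∏ i ∈ range (n - k), (1 + ε + (k : ℚ) + (i : ℚ))) * (∏ l ∈ range k, (1 + ε + (l : ℚ))) =
      ∏ l ∈ range n, (1 + ε + (l : ℚ)) := by
  rw [← pw_def, ← pw_def, ← pw_def]
  have h : pw (1 + ε) n = pw (1 + ε) k * pw (1 + ε + (k : ℚ)) (n - k) := by
    rw [← pw_add, Nat.add_sub_cancel' hk]
  rw [h]
  ring

/-- `(ε−(r+1)n+k)_{n−k} = (−1)^{n−k} (rn+1−ε)_{n−k}`. [folklore] -/
private theorem core_v (n r k : ℕ) (hk : k ≤ n) (ε : ℚ) :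
    ∏ i ∈ range (n - k), (1 + (2 * ε - n) - (((r * n : ℕ) : ℚ) + ε + 1) + k + (i : ℚ)) =
      (-1) ^ (n - k) * pw (((r * n : ℕ) : ℚ) + 1 - ε) (n - k) := by
  rw [← pw_def, pw_congr (show (1 : ℚ) + (2 * ε - n) - (((r * n : ℕ) : ℚ) + ε + 1) + k =
    -((((r * n : ℕ) : ℚ) + ((n - k : ℕ) : ℚ)) - ε) by rw [Nat.cast_sub hk]; ring) (n - k), pw_neg_rev]
  congr 1
  exact pw_congr (by ring) _

/-- `(1−ε)_{n−k} (n−k+1−ε)_{rn} = (1−ε)_{rn} (rn+1−ε)_{n−k}` (both `= (1−ε)_{rn+n−k}`). [folklore] -/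
private theorem core_c5 (n r k : ℕ) (ε : ℚ) :
    (∏ l ∈ range (n - k), (1 - ε + (l : ℚ))) * pw (((n - k : ℕ) : ℚ) + 1 - ε) (r * n) =
      (∏ l ∈ range (r * n), (1 - ε + (l : ℚ))) * pw (((r * n : ℕ) : ℚ) + 1 - ε) (n - k) := by
  rw [← pw_def, ← pw_def]
  have h1 : pw (1 - ε) ((n - k) + r * n) = pw (1 - ε) (n - k) * pw (((n - k : ℕ) : ℚ) + 1 - ε) (r * n) := by
    rw [pw_add]; congr 1; exact pw_congr (by ring) _
  have h2 : pw (1 - ε) (r * n + (n - k)) = pw (1 - ε) (r * n) * pw (((r * n : ℕ) : ℚ) + 1 - ε) (n - k) := by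
    rw [pw_add]; congr 1; exact pw_congr (by push_cast; ring) _
  rw [← h1, ← h2, Nat.add_comm]

/-- `(1+ε)_k (k+1+ε)_{rn} = (1+ε)_{rn} (rn+1+ε)_k`. [folklore] -/
private theorem core_c6 (n r k : ℕ) (ε : ℚ) :
    (∏ l ∈ range k, (1 + ε + (l : ℚ))) * pw ((k : ℚ) + 1 + ε) (r * n) =
      (∏ l ∈ range (r * n), (1 + ε + (l : ℚ))) * ∏ j ∈ range k, (((r * n : ℕ) : ℚ) + ε + 1 + j) := by
  rw [← pw_def, ← pw_def, ← pw_def]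
  have h1 : pw (1 + ε) (k + r * n) = pw (1 + ε) k * pw ((k : ℚ) + 1 + ε) (r * n) := by
    rw [pw_add]; congr 1; exact pw_congr (by ring) _
  have h2 : pw (1 + ε) (r * n + k) = pw (1 + ε) (r * n) * pw (((r * n : ℕ) : ℚ) + ε + 1) k := by
    rw [pw_add]; congr 1; exact pw_congr (by push_cast; ring) _
  rw [← h1, ← h2, Nat.add_comm]

/-- `(1−ε)_n = (1−ε)_{n−k} (n−k+1−ε)_k`. [folklore] -/
private theorem core_dm {n k : ℕ} (hk : k ≤ n) (ε : ℚ) :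
    ∏ l ∈ range n, (1 - ε + (l : ℚ)) = (∏ l ∈ range (n - k), (1 - ε + (l : ℚ))) * pw (((n - k : ℕ) : ℚ) + 1 - ε) k := by
  rw [← pw_def, ← pw_def]
  have h : pw (1 - ε) n = pw (1 - ε) (n - k) * pw (1 - ε + ((n - k : ℕ) : ℚ)) k := by
    rw [← pw_add, Nat.sub_add_cancel hk]
  rw [h]
  congr 1
  exact pw_congr (by ring) _

/-- The block bricks times `n!^r` are plain Pochhammer symbols. [folklore] -/
private theorem pbBlockMinus_mul (n r K : ℕ) (ε : ℚ) :
    pbBlockMinus n r K ε * (n ! : ℚ) ^ r = pw ((K : ℚ) - ε) (r * n) := by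
  unfold pbBlockMinus polyBrick
  rw [prod_div_distrib, prod_const, card_range, div_mul_cancel₀ _ (by positivity), pw_mul_blocks]
  refine prod_congr rfl fun q _ => ?_
  rw [← pw_def]
  exact pw_congr (by push_cast; ring) _

/-- The block bricks times `n!^r` are plain Pochhammer symbols. [folklore] -/
private theorem pbBlockPlus_mul (n r K : ℕ) (ε : ℚ) :
    pbBlockPlus n r K ε * (n ! : ℚ) ^ r = pw ((K : ℚ) + ε) (r * n) := by
  unfold pbBlockPlus polyBrick
  rw [prod_div_distrib, prod_const, card_range, div_mul_cancel₀ _ (by positivity), pw_mul_blocks]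
  refine prod_congr rfl fun q _ => ?_
  rw [← pw_def]
  exact pw_congr (by push_cast; ring) _

/-- `C(n,k) k! (n−k)! = n!` in `ℚ`. [folklore] -/
private theorem choose_mul_cast {n k : ℕ} (hk : k ≤ n) : ((n.choose k : ℕ) : ℚ) * (k ! : ℚ) * ((n - k)! : ℚ) = (n ! : ℚ) := by
  exact_mod_cast Nat.choose_mul_factorial_mul_factorial hk

/-- Level identity 1: `brOne = (1+ε)_n² · lvlOne` (off the zeros of `(1+ε)_k`).
[cite: KrattenthalerRivoal2007, §12 (eq:briques)] -/
theorem brOne_eq (n k : ℕ) (hk : k ≤ n) {ε : ℚ} (hP : ∏ l ∈ range k, (1 + ε + (l : ℚ)) ≠ 0) :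
    brOne n k ε = (∏ l ∈ range n, (1 + ε + (l : ℚ))) ^ 2 * lvlOne k ε := by
  unfold brOne lvlOne polyBrick rbPlus
  have e1 : ∏ i ∈ range (n - k), (1 + (2 * ε - n) - (ε - n) + k + (i : ℚ)) = ∏ i ∈ range (n - k), (1 + ε + (k : ℚ) + (i : ℚ)) :=
    prod_congr rfl fun i _ => by ring
  have e2 : ∏ l ∈ range k, (2 * ε + (((1 : ℤ) : ℤ) : ℚ) + (l : ℚ)) = ∏ j ∈ range k, (1 + 2 * ε + (j : ℚ)) :=
    prod_congr rfl fun i _ => by push_cast; ring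
  have e3 : ∏ j ∈ range k, ((1 : ℚ) + j) = (k ! : ℚ) := by
    rw [← prod_range_add_one_eq_factorial]; push_cast; exact prod_congr rfl fun i _ => by ring
  rw [e1, e2, e3, ← core_p hk ε]
  have hk0 : (k ! : ℚ) ≠ 0 := by positivity
  field_simp

/-- Level identity 2: `n!² · brXX = ((1−ε)_n(1+ε)_n)² · lvlXX` (off the zeros of `(1+ε)_k (1−ε)_{n−k}`).
[cite: KrattenthalerRivoal2007, §12 (eq:briques)] -/
theorem brXX_eq (n k : ℕ) (hk : k ≤ n) {ε : ℚ} (hP : ∏ l ∈ range k, (1 + ε + (l : ℚ)) ≠ 0)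
    (hM : ∏ l ∈ range (n - k), (1 - ε + (l : ℚ)) ≠ 0) :
    (n ! : ℚ) ^ 2 * brXX n k ε =
      ((∏ l ∈ range n, (1 - ε + (l : ℚ))) * ∏ l ∈ range n, (1 + ε + (l : ℚ))) ^ 2 * lvlXX n k ε := by
  unfold brXX lvlXX rbPlus rbMinus
  have e1 : ∏ i ∈ range (n - k), (1 + (2 * ε - n) - (ε - n) + k + (i : ℚ)) = ∏ i ∈ range (n - k), (1 + ε + (k : ℚ) + (i : ℚ)) :=
    prod_congr rfl fun i _ => by ring
  have hsq : ((-1 : ℚ) ^ k) ^ 2 = 1 := by rw [← pow_mul, mul_comm, pow_mul, neg_one_sq, one_pow]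
  have hDm : (∏ l ∈ range n, (1 - ε + (l : ℚ))) ^ 2 =
      ((∏ j ∈ range k, (ε - n + j)) * ∏ l ∈ range (n - k), (1 - ε + (l : ℚ))) ^ 2 := by
    rw [core_m hk, mul_pow, hsq, one_mul]
  rw [e1, mul_pow (∏ l ∈ range n, (1 - ε + (l : ℚ))), hDm, ← core_p hk ε, ← choose_mul_cast hk]
  have hk0 : (k ! : ℚ) ≠ 0 := by positivity
  have hnk0 : ((n - k)! : ℚ) ≠ 0 := by positivity
  field_simp

/-- Level identity 3: `n! (1−ε)_{rn} · brXY = n!^r (1−ε)_n² (1+ε)_n · lvlXY` (off the zeros of `(1+ε)_k (1−ε)_{n−k}`).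
[cite: KrattenthalerRivoal2007, §12 (eq:briques)] -/
theorem brXY_eq (n r k : ℕ) (hk : k ≤ n) {ε : ℚ} (hP : ∏ l ∈ range k, (1 + ε + (l : ℚ)) ≠ 0)
    (hM : ∏ l ∈ range (n - k), (1 - ε + (l : ℚ)) ≠ 0) :
    (n ! : ℚ) * (∏ l ∈ range (r * n), (1 - ε + (l : ℚ))) * brXY n r k ε =
      (n ! : ℚ) ^ r * (∏ l ∈ range n, (1 - ε + (l : ℚ))) ^ 2 * (∏ l ∈ range n, (1 + ε + (l : ℚ))) * lvlXY n r k ε := by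
  have hb : lvlXY n r k ε * (n ! : ℚ) ^ r =
      (-1) ^ (n - k) * (((n.choose k : ℕ) : ℚ) * rbPlus k ε * rbMinus (n - k) ε) * pw (((n - k + 1 : ℕ) : ℚ) - ε) (r * n) := by
    unfold lvlXY; rw [← pbBlockMinus_mul n r (n - k + 1) ε]; ring
  have hnr : (n ! : ℚ) ^ r ≠ 0 := by positivity
  rw [show (n ! : ℚ) ^ r * (∏ l ∈ range n, (1 - ε + (l : ℚ))) ^ 2 * (∏ l ∈ range n, (1 + ε + (l : ℚ))) * lvlXY n r k ε =
    (∏ l ∈ range n, (1 - ε + (l : ℚ))) ^ 2 * (∏ l ∈ range n, (1 + ε + (l : ℚ))) * (lvlXY n r k ε * (n ! : ℚ) ^ r) by ring, hb]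
  unfold brXY rbPlus rbMinus
  have e1 : ∏ i ∈ range (n - k), (1 + (2 * ε - n) - (ε - n) + k + (i : ℚ)) = ∏ i ∈ range (n - k), (1 + ε + (k : ℚ) + (i : ℚ)) :=
    prod_congr rfl fun i _ => by ring
  rw [e1, core_v n r k hk ε]
  -- atoms
  set X := ∏ j ∈ range k, (ε - n + (j : ℚ)) with hX
  set T := ∏ i ∈ range (n - k), (1 + ε + (k : ℚ) + (i : ℚ)) with hT
  set Pk := ∏ l ∈ range k, (1 + ε + (l : ℚ)) with hPk
  set Pm := ∏ l ∈ range (n - k), (1 - ε + (l : ℚ)) with hPm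
  set Dm := ∏ l ∈ range n, (1 - ε + (l : ℚ)) with hDm
  set Dp := ∏ l ∈ range n, (1 + ε + (l : ℚ)) with hDp
  set Rm := ∏ l ∈ range (r * n), (1 - ε + (l : ℚ)) with hRm
  set W := pw (((n - k + 1 : ℕ) : ℚ) - ε) (r * n) with hW
  set W' := pw (((r * n : ℕ) : ℚ) + 1 - ε) (n - k) with hW'
  set Q := pw (((n - k : ℕ) : ℚ) + 1 - ε) k with hQ
  have c1 : X * Pm = (-1) ^ k * Dm := core_m hk ε
  have c2 : T * Pk = Dp := core_p hk ε
  have c5 : Pm * W = Rm * W' := by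
    rw [hW, show (((n - k + 1 : ℕ) : ℚ) - ε) = ((n - k : ℕ) : ℚ) + 1 - ε by push_cast; ring]
    exact core_c5 n r k ε
  have cdm : Dm = Pm * Q := core_dm hk ε
  have c3 := choose_mul_cast hk
  have hk0 : (k ! : ℚ) ≠ 0 := by positivity
  have hnk0 : ((n - k)! : ℚ) ≠ 0 := by positivity
  -- `X = (−1)^k Q`: from `c1` and `cdm`
  have cX : X = (-1) ^ k * Q := by
    have : X * Pm = ((-1) ^ k * Q) * Pm := by rw [c1, cdm]; ring
    exact mul_right_cancel₀ hM this
  have hsq : ((-1 : ℚ) ^ k) ^ 2 = 1 := by rw [← pow_mul, mul_comm, pow_mul, neg_one_sq, one_pow]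
  apply mul_right_cancel₀ (mul_ne_zero hP hM)
  rw [show Dm ^ 2 * Dp * ((-1) ^ (n - k) * (((n.choose k : ℕ) : ℚ) * ((k ! : ℚ) / Pk) * (((n - k)! : ℚ) / Pm)) * W) * (Pk * Pm) =
      Dm ^ 2 * Dp * (-1) ^ (n - k) * ((n.choose k : ℕ) : ℚ) * W * ((k ! : ℚ) / Pk * Pk) * (((n - k)! : ℚ) / Pm * Pm) by ring,
    div_mul_cancel₀ _ hP, div_mul_cancel₀ _ hM, ← c2, cdm, cX, mul_pow, hsq, one_mul, ← c3]
  linear_combination (-((((n.choose k : ℕ) : ℚ) * (k ! : ℚ) * ((n - k)! : ℚ)) * Q ^ 2 * T * (-1 : ℚ) ^ (n - k) * Pk * Pm)) * c5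

/-- Level identity 4: `(1−ε)_{rn}(1+ε)_{rn} · brYY = n!^{2r} (1−ε)_n (1+ε)_n · lvlYY`.
[cite: KrattenthalerRivoal2007, §12 (eq:briques)] -/
theorem brYY_eq (n r k : ℕ) (hk : k ≤ n) (ε : ℚ) :
    (∏ l ∈ range (r * n), (1 - ε + (l : ℚ))) * (∏ l ∈ range (r * n), (1 + ε + (l : ℚ))) * brYY n r k ε =
      (n ! : ℚ) ^ (2 * r) * (∏ l ∈ range n, (1 - ε + (l : ℚ))) * (∏ l ∈ range n, (1 + ε + (l : ℚ))) * lvlYY n r k ε := by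
  have hb : lvlYY n r k ε * (n ! : ℚ) ^ (2 * r) =
      (-1) ^ n * pw (((n - k + 1 : ℕ) : ℚ) - ε) (r * n) * pw (((k + 1 : ℕ) : ℚ) + ε) (r * n) := by
    unfold lvlYY
    rw [← pbBlockMinus_mul n r (n - k + 1) ε, ← pbBlockPlus_mul n r (k + 1) ε, pow_mul, sq]
    ring
  rw [show (n ! : ℚ) ^ (2 * r) * (∏ l ∈ range n, (1 - ε + (l : ℚ))) * (∏ l ∈ range n, (1 + ε + (l : ℚ))) * lvlYY n r k ε =
    (∏ l ∈ range n, (1 - ε + (l : ℚ))) * (∏ l ∈ range n, (1 + ε + (l : ℚ))) * (lvlYY n r k ε * (n ! : ℚ) ^ (2 * r)) by ring, hb]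
  unfold brYY
  have e1 : ∏ i ∈ range (n - k), (1 + (2 * ε - n) - (ε - n) + k + (i : ℚ)) = ∏ i ∈ range (n - k), (1 + ε + (k : ℚ) + (i : ℚ)) :=
    prod_congr rfl fun i _ => by ring
  rw [e1, core_v n r k hk ε]
  set X := ∏ j ∈ range k, (ε - n + (j : ℚ)) with hX
  set Y := ∏ j ∈ range k, (((r * n : ℕ) : ℚ) + ε + 1 + j) with hY
  set T := ∏ i ∈ range (n - k), (1 + ε + (k : ℚ) + (i : ℚ)) with hT
  set Pk := ∏ l ∈ range k, (1 + ε + (l : ℚ)) with hPk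
  set Pm := ∏ l ∈ range (n - k), (1 - ε + (l : ℚ)) with hPm
  set Dm := ∏ l ∈ range n, (1 - ε + (l : ℚ)) with hDm
  set Dp := ∏ l ∈ range n, (1 + ε + (l : ℚ)) with hDp
  set Rm := ∏ l ∈ range (r * n), (1 - ε + (l : ℚ)) with hRm
  set Rp := ∏ l ∈ range (r * n), (1 + ε + (l : ℚ)) with hRp
  set W := pw (((n - k + 1 : ℕ) : ℚ) - ε) (r * n) with hW
  set Wp := pw (((k + 1 : ℕ) : ℚ) + ε) (r * n) with hWp
  set W' := pw (((r * n : ℕ) : ℚ) + 1 - ε) (n - k) with hW'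
  set Q := pw (((n - k : ℕ) : ℚ) + 1 - ε) k with hQ
  have c1 : X * Pm = (-1) ^ k * Dm := core_m hk ε
  have c2 : T * Pk = Dp := core_p hk ε
  have c5 : Pm * W = Rm * W' := by
    rw [hW, show (((n - k + 1 : ℕ) : ℚ) - ε) = ((n - k : ℕ) : ℚ) + 1 - ε by push_cast; ring]
    exact core_c5 n r k ε
  have c6 : Pk * Wp = Rp * Y := by
    rw [hWp, show (((k + 1 : ℕ) : ℚ) + ε) = (k : ℚ) + 1 + ε by push_cast; ring]
    exact core_c6 n r k ε
  have cdm : Dm = Pm * Q := core_dm hk ε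
  have hs : (-1 : ℚ) ^ k * (-1) ^ (n - k) = (-1) ^ n := by rw [← pow_add, Nat.add_sub_cancel' hk]
  have hm : Rm * X * W' = (-1) ^ k * Dm * W := by
    calc Rm * X * W' = X * (Rm * W') := by ring
      _ = X * (Pm * W) := by rw [c5]
      _ = X * Pm * W := by ring
      _ = _ := by rw [c1]
  have hp : Rp * Y * T = Dp * Wp := by
    calc Rp * Y * T = T * (Rp * Y) := by ring
      _ = T * (Pk * Wp) := by rw [c6]
      _ = T * Pk * Wp := by ring
      _ = _ := by rw [c2]
  calc Rm * Rp * (X * Y * T * ((-1) ^ (n - k) * W'))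
      = (-1) ^ (n - k) * (Rm * X * W') * (Rp * Y * T) := by ring
    _ = (-1) ^ (n - k) * ((-1) ^ k * Dm * W) * (Dp * Wp) := by rw [hm, hp]
    _ = Dm * Dp * ((-1) ^ n * W * Wp) := by rw [← hs]; ring

/-! ### The dictionary: raw inner sums × explicit normalisers = normalised inner sums -/

/-- Sub-products of a nonvanishing product do not vanish. [folklore] -/
private theorem prod_range_ne_zero_of_le {f : ℕ → ℚ} {k n : ℕ} (hk : k ≤ n) (h : ∏ l ∈ range n, f l ≠ 0) :
    ∏ l ∈ range k, f l ≠ 0 :=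
  prod_ne_zero_iff.2 fun l hl => (prod_ne_zero_iff.1 h) l (mem_range.2 (lt_of_lt_of_le (mem_range.1 hl) hk))

/-- Dictionary for the `(x,y)`-chain: `((1−ε)_{rn}(1+ε)_{rn})^b · rawYY b k = (n!^{2r}(1−ε)_n(1+ε)_n)^b · innerYY b k`.
[cite: KrattenthalerRivoal2007, §12 (eq:briques)] -/
theorem rawYY_dictionary (n r : ℕ) (ε : ℚ) : ∀ b k, k ≤ n →
    ((∏ l ∈ range (r * n), (1 - ε + (l : ℚ))) * ∏ l ∈ range (r * n), (1 + ε + (l : ℚ))) ^ b * rawYY n r b k ε =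
      ((n ! : ℚ) ^ (2 * r) * (∏ l ∈ range n, (1 - ε + (l : ℚ))) * ∏ l ∈ range n, (1 + ε + (l : ℚ))) ^ b *
        innerYY n r b k ε := by
  intro b
  induction b with
  | zero => intro k _; simp [rawYY_zero, innerYY]
  | succ b ih =>
    intro k hk
    set RR := (∏ l ∈ range (r * n), (1 - ε + (l : ℚ))) * ∏ l ∈ range (r * n), (1 + ε + (l : ℚ)) with hRR
    set DD := (n ! : ℚ) ^ (2 * r) * (∏ l ∈ range n, (1 - ε + (l : ℚ))) * ∏ l ∈ range n, (1 + ε + (l : ℚ)) with hDD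
    have hlev : RR * brYY n r k ε = DD * lvlYY n r k ε := by
      rw [hRR, hDD]; exact brYY_eq n r k hk ε
    have h1 : RR ^ (b + 1) * rawYY n r (b + 1) k ε =
        (RR * brYY n r k ε) * ∑ i ∈ range (k + 1), (k.choose i : ℚ) * gapXY n r k i * (RR ^ b * rawYY n r b i ε) := by
      rw [rawYY_succ n r b k hk ε]
      simp only [mul_sum]
      refine sum_congr rfl fun i _ => ?_
      ring
    have h2 : ∑ i ∈ range (k + 1), (k.choose i : ℚ) * gapXY n r k i * (RR ^ b * rawYY n r b i ε) =
        DD ^ b * ∑ i ∈ range (k + 1), (k.choose i : ℚ) * gapXY n r k i * innerYY n r b i ε := by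
      rw [mul_sum]
      refine sum_congr rfl fun i hi => ?_
      rw [ih i ((Nat.lt_succ_iff.mp (mem_range.mp hi)).trans hk)]
      ring
    rw [h1, h2, hlev, show innerYY n r (b + 1) k ε =
      lvlYY n r k ε * ∑ i ∈ range (k + 1), (k.choose i : ℚ) * gapXY n r k i * innerYY n r b i ε by rw [innerYY]]
    ring

/-- The normalisers of the `(x,y)`-chain below `(x,x)` (`B'` pairs): left `E_X` (raw side), right `D_X` (brick side).
[cite: KrattenthalerRivoal2007, §12 (eq:briques)] -/
def normEX (n r : ℕ) (ε : ℚ) : ℕ → ℚ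
  | 0 => 1
  | b + 1 => (n ! : ℚ) * (∏ l ∈ range (r * n), (1 - ε + (l : ℚ))) *
      ((∏ l ∈ range (r * n), (1 - ε + (l : ℚ))) * ∏ l ∈ range (r * n), (1 + ε + (l : ℚ))) ^ b

/-- See `normEX`. [cite: KrattenthalerRivoal2007, §12 (eq:briques)] -/
def normDX (n r : ℕ) (ε : ℚ) : ℕ → ℚ
  | 0 => 1
  | b + 1 => (n ! : ℚ) ^ r * (∏ l ∈ range n, (1 - ε + (l : ℚ))) ^ 2 * (∏ l ∈ range n, (1 + ε + (l : ℚ))) *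
      ((n ! : ℚ) ^ (2 * r) * (∏ l ∈ range n, (1 - ε + (l : ℚ))) * ∏ l ∈ range n, (1 + ε + (l : ℚ))) ^ b

/-- Dictionary for the `(x,y)`-chain below `(x,x)`: `E_X · rawX B' k = D_X · innerX B' k` (off the zeros of
`(1−ε)_n (1+ε)_n`). [cite: KrattenthalerRivoal2007, §12 (eq:briques)] -/
theorem rawX_dictionary (n r B' k : ℕ) (hk : k ≤ n) {ε : ℚ} (hDp : ∏ l ∈ range n, (1 + ε + (l : ℚ)) ≠ 0)
    (hDm : ∏ l ∈ range n, (1 - ε + (l : ℚ)) ≠ 0) :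
    normEX n r ε B' * rawX n r B' k ε = normDX n r ε B' * innerX n r B' k ε := by
  cases B' with
  | zero => simp [normEX, normDX, rawX_zero, innerX]
  | succ b =>
    set RR := (∏ l ∈ range (r * n), (1 - ε + (l : ℚ))) * ∏ l ∈ range (r * n), (1 + ε + (l : ℚ)) with hRR
    set DD := (n ! : ℚ) ^ (2 * r) * (∏ l ∈ range n, (1 - ε + (l : ℚ))) * ∏ l ∈ range n, (1 + ε + (l : ℚ)) with hDD
    have hlev := brXY_eq n r k hk (prod_range_ne_zero_of_le hk hDp) (prod_range_ne_zero_of_le (Nat.sub_le n k) hDm)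
    have h1 : normEX n r ε (b + 1) * rawX n r (b + 1) k ε =
        ((n ! : ℚ) * (∏ l ∈ range (r * n), (1 - ε + (l : ℚ))) * brXY n r k ε) *
          ∑ i ∈ range (k + 1), (k.choose i : ℚ) * gapXY n r k i * (RR ^ b * rawYY n r b i ε) := by
      rw [normEX, rawX_succ n r b k hk ε]
      simp only [mul_sum]
      refine sum_congr rfl fun i _ => ?_
      ring
    have h2 : ∑ i ∈ range (k + 1), (k.choose i : ℚ) * gapXY n r k i * (RR ^ b * rawYY n r b i ε) =
        DD ^ b * ∑ i ∈ range (k + 1), (k.choose i : ℚ) * gapXY n r k i * innerYY n r b i ε := by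
      rw [mul_sum]
      refine sum_congr rfl fun i hi => ?_
      rw [rawYY_dictionary n r ε b i ((Nat.lt_succ_iff.mp (mem_range.mp hi)).trans hk)]
      ring
    rw [h1, h2, hlev, normDX, show innerX n r (b + 1) k ε =
      lvlXY n r k ε * ∑ i ∈ range (k + 1), (k.choose i : ℚ) * gapXY n r k i * innerYY n r b i ε by rw [innerX]]
    ring

/-- Dictionary for the `(x,x)`-chain: `(n!²)^{m'} E_X · rawXX m' k = (((1−ε)_n(1+ε)_n)²)^{m'} D_X · innerXX m' k`.
[cite: KrattenthalerRivoal2007, §12 (eq:briques)] -/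
theorem rawXX_dictionary (n r B' : ℕ) {ε : ℚ} (hDp : ∏ l ∈ range n, (1 + ε + (l : ℚ)) ≠ 0)
    (hDm : ∏ l ∈ range n, (1 - ε + (l : ℚ)) ≠ 0) : ∀ m' k, k ≤ n →
    ((n ! : ℚ) ^ 2) ^ m' * normEX n r ε B' * rawXX n r B' m' k ε =
      (((∏ l ∈ range n, (1 - ε + (l : ℚ))) * ∏ l ∈ range n, (1 + ε + (l : ℚ))) ^ 2) ^ m' * normDX n r ε B' *
        innerXX n r B' m' k ε := by
  intro m'
  induction m' with
  | zero =>
    intro k hk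
    rw [pow_zero, pow_zero, one_mul, one_mul, rawXX_zero, rawX_dictionary n r B' k hk hDp hDm, innerXX]
  | succ m' ih =>
    intro k hk
    set NN := (n ! : ℚ) ^ 2 with hNN
    set DD := ((∏ l ∈ range n, (1 - ε + (l : ℚ))) * ∏ l ∈ range n, (1 + ε + (l : ℚ))) ^ 2 with hDD
    have hlev := brXX_eq n k hk (prod_range_ne_zero_of_le hk hDp) (prod_range_ne_zero_of_le (Nat.sub_le n k) hDm)
    have h1 : NN ^ (m' + 1) * normEX n r ε B' * rawXX n r B' (m' + 1) k ε =
        (NN * brXX n k ε) * ∑ i ∈ range (k + 1), (k.choose i : ℚ) * gapXX n k i *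
          (NN ^ m' * normEX n r ε B' * rawXX n r B' m' i ε) := by
      rw [rawXX_succ n r B' m' k hk ε]
      simp only [mul_sum]
      refine sum_congr rfl fun i _ => ?_
      ring
    have h2 : ∑ i ∈ range (k + 1), (k.choose i : ℚ) * gapXX n k i * (NN ^ m' * normEX n r ε B' * rawXX n r B' m' i ε) =
        DD ^ m' * normDX n r ε B' * ∑ i ∈ range (k + 1), (k.choose i : ℚ) * gapXX n k i * innerXX n r B' m' i ε := by
      rw [mul_sum]
      refine sum_congr rfl fun i hi => ?_
      rw [ih i ((Nat.lt_succ_iff.mp (mem_range.mp hi)).trans hk)]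
      ring
    rw [h1, h2, hNN, hlev, show innerXX n r B' (m' + 1) k ε =
      lvlXX n k ε * ∑ i ∈ range (k + 1), (k.choose i : ℚ) * gapXX n k i * innerXX n r B' m' i ε by rw [innerXX]]
    ring

/-- **The dictionary for the whole inner chain**: off the zeros of `(1−ε)_n (1+ε)_n` (in particular near `ε = 0`),
`(n!²)^M · E_X(ε) · rawInner(k)(ε) = (1+ε)_n² · (((1−ε)_n(1+ε)_n)²)^M · D_X(ε) · inner(k)(ε)` for `k ≤ n`, with
`E_X = n!(1−ε)_{rn}((1−ε)_{rn}(1+ε)_{rn})^{B'−1}`, `D_X = n!^r(1−ε)_n²(1+ε)_n(n!^{2r}(1−ε)_n(1+ε)_n)^{B'−1}` (`= 1, 1`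
for `B' = 0`). So the raw inner factor of `sPolThree` is an explicit unit-times-`d_n`-integral function (`inner_isDInt`).
[cite: KrattenthalerRivoal2007, §12 proof of Proposition 6, (eq:briques)] -/
theorem rawInner_dictionary (n r M B' k : ℕ) (hk : k ≤ n) {ε : ℚ} (hDp : ∏ l ∈ range n, (1 + ε + (l : ℚ)) ≠ 0)
    (hDm : ∏ l ∈ range n, (1 - ε + (l : ℚ)) ≠ 0) :
    ((n ! : ℚ) ^ 2) ^ M * normEX n r ε B' * rawInner n r M B' k ε =
      (∏ l ∈ range n, (1 + ε + (l : ℚ))) ^ 2 *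
        (((∏ l ∈ range n, (1 - ε + (l : ℚ))) * ∏ l ∈ range n, (1 + ε + (l : ℚ))) ^ 2) ^ M * normDX n r ε B' *
        inner n r M B' k ε := by
  set NN := (n ! : ℚ) ^ 2 with hNN
  set DD := ((∏ l ∈ range n, (1 - ε + (l : ℚ))) * ∏ l ∈ range n, (1 + ε + (l : ℚ))) ^ 2 with hDD
  have hlev := brOne_eq n k hk (prod_range_ne_zero_of_le hk hDp)
  have h1 : NN ^ M * normEX n r ε B' * rawInner n r M B' k ε =
      brOne n k ε * ∑ i ∈ range (k + 1), (k.choose i : ℚ) * gapXX n k i *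
        (NN ^ M * normEX n r ε B' * rawXX n r B' M i ε) := by
    rw [rawInner_eq n r M B' k hk ε]
    simp only [mul_sum]
    refine sum_congr rfl fun i _ => ?_
    ring
  have h2 : ∑ i ∈ range (k + 1), (k.choose i : ℚ) * gapXX n k i * (NN ^ M * normEX n r ε B' * rawXX n r B' M i ε) =
      DD ^ M * normDX n r ε B' * ∑ i ∈ range (k + 1), (k.choose i : ℚ) * gapXX n k i * innerXX n r B' M i ε := by
    rw [mul_sum]
    refine sum_congr rfl fun i hi => ?_
    rw [hNN, hDD, rawXX_dictionary n r B' hDp hDm M i ((Nat.lt_succ_iff.mp (mem_range.mp hi)).trans hk)]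
    ring
  rw [h1, h2, hlev, inner]
  ring

/-- `sPolThree` in terms of the raw inner factor: its `k`-th summand is
`C(n,k) (ε−n)_k (rn+ε+1)_k · rawInner(k) · W(…)(n−k)`. [cite: KrattenthalerRivoal2007, §12 proof of Proposition 6] -/
theorem sPolThree_eq_sum_rawInner (ε : ℚ) (n M B' r : ℕ) :
    sPolThree ε n M B' r = ∑ k ∈ range (n + 1), (n.choose k : ℚ) * (∏ j ∈ range k, (ε - n + j)) *
      (∏ j ∈ range k, (((r * n : ℕ) : ℚ) + ε + 1 + j)) * rawInner n r M B' k ε *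
      balFourFThree (ε - n + k) (-ε - n) (((r * n : ℕ) : ℚ) + k + 2) (ε + 1 - ((n - k : ℕ) : ℚ))
        (1 - ε - ((n - k : ℕ) : ℚ)) (n - k) := by
  unfold sPolThree rawInner
  refine sum_congr rfl fun k _ => ?_
  ring

/-! ### The multinomial refinement: `inner(k) = k! · innerFlat(k)`

KR's multiple sum carries the multinomial `i_{A/2+B}!/(i₁!(i₂−i₁)!⋯)` rather than the chain of binomials
`C(k,i)` of `BaileyChain.reducedMultiSum`; regrouping `C(k,i)·gap = (k!/i!)·(gap/(k−i)!)` along the chain (the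
`k!/i!` telescope to the top index `k!`, the innermost index being `0`) leaves at every level the INTEGER weights
`(n+1)_{k−i}/(k−i)! = C(n+k−i,k−i)` (KR's `R(i_k−i_{k−1},0;n+1)`) and `(−rn)_{k−i}/(k−i)! = ±C(rn,k−i)` (KR's
`binom(rn, i_k−i_{k−1})`), and a global `k!` which the top level needs. -/

/-- The integer weight `(n+1)_{k−i}/(k−i)!`. [cite: KrattenthalerRivoal2007, §12 (eq:briques) (R(i_k−i_{k−1},0;n+1))] -/
def wXX (n k i : ℕ) : ℚ := gapXX n k i / ((k - i)! : ℚ)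

/-- The integer weight `(−rn)_{k−i}/(k−i)!`. [cite: KrattenthalerRivoal2007, §12 (eq:briques) (binom(rn, i_k−i_{k−1}))] -/
def wXY (n r k i : ℕ) : ℚ := gapXY n r k i / ((k - i)! : ℚ)

/-- `wXX n k i = C(n+k−i, k−i)` (KR's `R(i_k−i_{k−1},0;n+1)` at an integer point). [cite: KrattenthalerRivoal2007, §12 (eq:briques)] -/
theorem wXX_eq (n k i : ℕ) : wXX n k i = (((n + (k - i)).choose (k - i) : ℕ) : ℚ) := by
  unfold wXX gapXX
  have hf : ((k - i)! : ℚ) ≠ 0 := by positivity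
  have hn : (n ! : ℚ) ≠ 0 := by positivity
  rw [div_eq_iff hf]
  have h1 : (∏ j ∈ range (k - i), ((n : ℚ) + 1 + j)) * (n ! : ℚ) = ((n + (k - i))! : ℚ) := by
    have := Nat.factorial_mul_ascFactorial n (k - i)
    rw [Nat.ascFactorial_eq_prod_range] at this
    rw [mul_comm]
    exact_mod_cast this
  have h2 : (((n + (k - i)).choose (k - i) : ℕ) : ℚ) * (n ! : ℚ) * ((k - i)! : ℚ) = ((n + (k - i))! : ℚ) := by
    exact_mod_cast Nat.add_choose_mul_factorial_mul_factorial n (k - i)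
  apply mul_right_cancel₀ hn
  rw [h1]
  linear_combination -h2

/-- `(−N)_m = (−1)^m · N^{(m)}` (falling factorial). [folklore] -/
private theorem prod_neg_add_eq_descFactorial (N m : ℕ) :
    ∏ j ∈ range m, (-(N : ℚ) + j) = (-1) ^ m * (N.descFactorial m : ℚ) := by
  induction m with
  | zero => simp
  | succ m ih =>
    rw [prod_range_succ, ih, Nat.descFactorial_succ, pow_succ]
    rcases Nat.lt_or_ge N m with hm | hm
    · rw [Nat.descFactorial_eq_zero_iff_lt.2 hm]
      simp
    · push_cast [Nat.cast_sub hm]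
      ring

/-- `wXY n r k i = (−1)^{k−i} C(rn, k−i)` (KR's `binom(rn, i_k−i_{k−1})`). [cite: KrattenthalerRivoal2007, §12 (eq:briques)] -/
theorem wXY_eq (n r k i : ℕ) : wXY n r k i = (-1) ^ (k - i) * ((((r * n).choose (k - i)) : ℕ) : ℚ) := by
  unfold wXY gapXY
  rw [prod_neg_add_eq_descFactorial, Nat.descFactorial_eq_factorial_mul_choose]
  have hf : ((k - i)! : ℚ) ≠ 0 := by positivity
  push_cast
  field_simp

/-- Flat (multinomial-weight) version of `innerYY`. [cite: KrattenthalerRivoal2007, §12 (eq:briques)] -/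
def innerYYFlat (n r : ℕ) : ℕ → ℕ → ℚ → ℚ
  | 0, k, _ => if k = 0 then 1 else 0
  | b + 1, k, ε => lvlYY n r k ε * ∑ i ∈ range (k + 1), wXY n r k i * innerYYFlat n r b i ε

/-- Flat version of `innerX`. [cite: KrattenthalerRivoal2007, §12 (eq:briques)] -/
def innerXFlat (n r : ℕ) : ℕ → ℕ → ℚ → ℚ
  | 0, k, _ => if k = 0 then 1 else 0
  | b + 1, k, ε => lvlXY n r k ε * ∑ i ∈ range (k + 1), wXY n r k i * innerYYFlat n r b i ε

/-- Flat version of `innerXX`. [cite: KrattenthalerRivoal2007, §12 (eq:briques)] -/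
def innerXXFlat (n r B' : ℕ) : ℕ → ℕ → ℚ → ℚ
  | 0, k, ε => innerXFlat n r B' k ε
  | m' + 1, k, ε => lvlXX n k ε * ∑ i ∈ range (k + 1), wXX n k i * innerXXFlat n r B' m' i ε

/-- Flat version of `inner`: `inner(k) = k! · innerFlat(k)`. [cite: KrattenthalerRivoal2007, §12 (eq:briques)] -/
def innerFlat (n r M B' k : ℕ) (ε : ℚ) : ℚ :=
  lvlOne k ε * ∑ i ∈ range (k + 1), wXX n k i * innerXXFlat n r B' M i ε

/-- `C(k,i) · gap · i! = k! · (gap/(k−i)!)`. [folklore] -/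
private theorem choose_gap_factorial {k i : ℕ} (hik : i ≤ k) (g : ℚ) :
    (k.choose i : ℚ) * g * (i ! : ℚ) = (k ! : ℚ) * (g / ((k - i)! : ℚ)) := by
  have h : ((k.choose i : ℕ) : ℚ) * (i ! : ℚ) * ((k - i)! : ℚ) = (k ! : ℚ) := by
    exact_mod_cast Nat.choose_mul_factorial_mul_factorial hik
  have hf : ((k - i)! : ℚ) ≠ 0 := by positivity
  field_simp
  linear_combination g * h

/-- `[k=0] = k! · [k=0]`. [folklore] -/
private theorem ite_eq_factorial_mul (k : ℕ) : (if k = 0 then (1 : ℚ) else 0) = (k ! : ℚ) * (if k = 0 then 1 else 0) := by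
  split_ifs with h
  · subst h; simp
  · simp

/-- `innerYY b k = k! · innerYYFlat b k`. [cite: KrattenthalerRivoal2007, §12 (eq:briques)] -/
theorem innerYY_eq_flat (n r : ℕ) (ε : ℚ) : ∀ b k, innerYY n r b k ε = (k ! : ℚ) * innerYYFlat n r b k ε := by
  intro b
  induction b with
  | zero => intro k; simp only [innerYY, innerYYFlat]; exact ite_eq_factorial_mul k
  | succ b ih =>
    intro k
    simp only [innerYY, innerYYFlat]
    have hterm : ∀ i ∈ range (k + 1), (k.choose i : ℚ) * gapXY n r k i * innerYY n r b i ε =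
        (k ! : ℚ) * (wXY n r k i * innerYYFlat n r b i ε) := fun i hi => by
      have hik : i ≤ k := Nat.lt_succ_iff.mp (mem_range.mp hi)
      rw [ih i, wXY]
      linear_combination (innerYYFlat n r b i ε) * choose_gap_factorial hik (gapXY n r k i)
    rw [sum_congr rfl hterm, ← Finset.mul_sum]
    ring

/-- `innerX B' k = k! · innerXFlat B' k`. [cite: KrattenthalerRivoal2007, §12 (eq:briques)] -/
theorem innerX_eq_flat (n r : ℕ) (ε : ℚ) (B' k : ℕ) : innerX n r B' k ε = (k ! : ℚ) * innerXFlat n r B' k ε := by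
  cases B' with
  | zero => simp only [innerX, innerXFlat]; exact ite_eq_factorial_mul k
  | succ b =>
    simp only [innerX, innerXFlat]
    have hterm : ∀ i ∈ range (k + 1), (k.choose i : ℚ) * gapXY n r k i * innerYY n r b i ε =
        (k ! : ℚ) * (wXY n r k i * innerYYFlat n r b i ε) := fun i hi => by
      have hik : i ≤ k := Nat.lt_succ_iff.mp (mem_range.mp hi)
      rw [innerYY_eq_flat n r ε b i, wXY]
      linear_combination (innerYYFlat n r b i ε) * choose_gap_factorial hik (gapXY n r k i)
    rw [sum_congr rfl hterm, ← Finset.mul_sum]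
    ring

/-- `innerXX m' k = k! · innerXXFlat m' k`. [cite: KrattenthalerRivoal2007, §12 (eq:briques)] -/
theorem innerXX_eq_flat (n r B' : ℕ) (ε : ℚ) : ∀ m' k, innerXX n r B' m' k ε = (k ! : ℚ) * innerXXFlat n r B' m' k ε := by
  intro m'
  induction m' with
  | zero => intro k; simp only [innerXX, innerXXFlat]; exact innerX_eq_flat n r ε B' k
  | succ m' ih =>
    intro k
    simp only [innerXX, innerXXFlat]
    have hterm : ∀ i ∈ range (k + 1), (k.choose i : ℚ) * gapXX n k i * innerXX n r B' m' i ε =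
        (k ! : ℚ) * (wXX n k i * innerXXFlat n r B' m' i ε) := fun i hi => by
      have hik : i ≤ k := Nat.lt_succ_iff.mp (mem_range.mp hi)
      rw [ih i, wXX]
      linear_combination (innerXXFlat n r B' m' i ε) * choose_gap_factorial hik (gapXX n k i)
    rw [sum_congr rfl hterm, ← Finset.mul_sum]
    ring

/-- **`inner(k) = k! · innerFlat(k)`** (the multinomial regrouping). [cite: KrattenthalerRivoal2007, §12 (eq:briques)] -/
theorem inner_eq_flat (n r M B' k : ℕ) (ε : ℚ) : inner n r M B' k ε = (k ! : ℚ) * innerFlat n r M B' k ε := by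
  simp only [inner, innerFlat]
  have hterm : ∀ i ∈ range (k + 1), (k.choose i : ℚ) * gapXX n k i * innerXX n r B' M i ε =
      (k ! : ℚ) * (wXX n k i * innerXXFlat n r B' M i ε) := fun i hi => by
    have hik : i ≤ k := Nat.lt_succ_iff.mp (mem_range.mp hi)
    rw [innerXX_eq_flat n r B' ε M i, wXX]
    linear_combination (innerXXFlat n r B' M i ε) * choose_gap_factorial hik (gapXX n k i)
  rw [sum_congr rfl hterm, ← Finset.mul_sum]
  ring

/-- The flat weights are integers. [folklore] -/
private theorem wXX_isDInt (d N n k i : ℕ) : IsDInt d N (fun _ : ℚ => wXX n k i) 0 := by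
  rw [wXX_eq]; exact_mod_cast IsDInt.const d N ((n + (k - i)).choose (k - i) : ℤ) 0

/-- The flat weights are integers. [folklore] -/
private theorem wXY_isDInt (d N n r k i : ℕ) : IsDInt d N (fun _ : ℚ => wXY n r k i) 0 := by
  rw [wXY_eq]
  exact (IsDInt.const d N ((-1) ^ (k - i) * ((r * n).choose (k - i) : ℤ)) 0).congr
    (Eventually.of_forall fun _ => by push_cast; rfl)

/-- `innerYYFlat` is `IsDInt (d_n)` at `0` for `k ≤ n`. [cite: KrattenthalerRivoal2007, §12 proof of Prop. 6] -/
theorem innerYYFlat_isDInt (N : ℕ) : ∀ b k, k ≤ n → IsDInt (Nat.lcmUpto n) N (innerYYFlat n r b k) 0 := by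
  intro b
  induction b with
  | zero => intro k _; exact isDInt_ite _ N k
  | succ b ih =>
    intro k hk
    have hs := IsDInt.sum (range (k + 1)) (F := fun i ε => wXY n r k i * innerYYFlat n r b i ε)
      (d := Nat.lcmUpto n) (N := N) (x := 0) fun i hi =>
        (wXY_isDInt _ N n r k i).mul (ih i ((Nat.lt_succ_iff.mp (mem_range.mp hi)).trans hk))
    exact ((lvlYY_isDInt (n := n) (r := r) k N).mul hs).congr (Eventually.of_forall fun ε => by simp [innerYYFlat])

/-- `innerXFlat` is `IsDInt (d_n)` at `0` for `k ≤ n`. [cite: KrattenthalerRivoal2007, §12 proof of Prop. 6] -/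
theorem innerXFlat_isDInt (N B' k : ℕ) (hk : k ≤ n) : IsDInt (Nat.lcmUpto n) N (innerXFlat n r B' k) 0 := by
  cases B' with
  | zero => exact isDInt_ite _ N k
  | succ b =>
    have hs := IsDInt.sum (range (k + 1)) (F := fun i ε => wXY n r k i * innerYYFlat n r b i ε)
      (d := Nat.lcmUpto n) (N := N) (x := 0) fun i hi =>
        (wXY_isDInt _ N n r k i).mul (innerYYFlat_isDInt N b i ((Nat.lt_succ_iff.mp (mem_range.mp hi)).trans hk))
    exact ((lvlXY_isDInt (r := r) hk N).mul hs).congr (Eventually.of_forall fun ε => by simp [innerXFlat])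

/-- `innerXXFlat` is `IsDInt (d_n)` at `0` for `k ≤ n`. [cite: KrattenthalerRivoal2007, §12 proof of Prop. 6] -/
theorem innerXXFlat_isDInt (N B' : ℕ) : ∀ m' k, k ≤ n → IsDInt (Nat.lcmUpto n) N (innerXXFlat n r B' m' k) 0 := by
  intro m'
  induction m' with
  | zero =>
    intro k hk
    exact (innerXFlat_isDInt (r := r) N B' k hk).congr (Eventually.of_forall fun ε => by simp [innerXXFlat])
  | succ m' ih =>
    intro k hk
    have hs := IsDInt.sum (range (k + 1)) (F := fun i ε => wXX n k i * innerXXFlat n r B' m' i ε)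
      (d := Nat.lcmUpto n) (N := N) (x := 0) fun i hi =>
        (wXX_isDInt _ N n k i).mul (ih i ((Nat.lt_succ_iff.mp (mem_range.mp hi)).trans hk))
    exact ((lvlXX_isDInt hk N).mul hs).congr (Eventually.of_forall fun ε => by simp [innerXXFlat])

/-- **`innerFlat = inner/k!` is still `d_n`-integral to all orders** (`k ≤ n`).
[cite: KrattenthalerRivoal2007, §12 proof of Proposition 6, (eq:briques)–(eq:6)] -/
theorem innerFlat_isDInt (N M B' k : ℕ) (hk : k ≤ n) : IsDInt (Nat.lcmUpto n) N (innerFlat n r M B' k) 0 := by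
  have hs := IsDInt.sum (range (k + 1)) (F := fun i ε => wXX n k i * innerXXFlat n r B' M i ε)
    (d := Nat.lcmUpto n) (N := N) (x := 0) fun i hi =>
      (wXX_isDInt _ N n k i).mul (innerXXFlat_isDInt N B' M i ((Nat.lt_succ_iff.mp (mem_range.mp hi)).trans hk))
  exact ((lvlOne_isDInt hk N).mul hs).congr (Eventually.of_forall fun ε => by simp [innerFlat])

end Literature.NumberTheory.Irrationality.KrattenthalerRivoal2007
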